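import Mathlib
import Summits.ResolutionOfSingularities.ResolutionOfSingularities.Theorems.SyzygyFlatteningDefs
import Summits.ResolutionOfSingularities.ResolutionOfSingularities.Theorems.SyzygyFlatteningHigherRankTerminationTowerStageBasic
import Summits.ResolutionOfSingularities.ResolutionOfSingularities.Theorems.SyzygyFlatteningHigherRankTerminationLocAt
import Literature.AlgebraicGeometry.Resolution.ExcellentRings
import Literature.AlgebraicGeometry.Resolution.CanonicalResolutionProofs
import Literature.AlgebraicGeometry.Resolution.QuasiExcellentLocalization
import HarnessLib

/-!
# The ideal of the non-regular locus localises (`stub_singIdeal_locAt`)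

Crux `HigherRankTermination` (stmt-ResolutionOfSingularities-17045), line `birth`, registered
stub `stub_singIdeal_locAt`: for a model `B ⊆ O₁` essentially of finite type over the field `k`,
the ideal `singIdeal` of the non-regular locus (the intersection of the non-regular primes,
`Theorems/SyzygyFlatteningDefs.lean`) of the localisation `locAt O₁ B` of `B` at the centre of
`O₁` is the extension of `singIdeal B` along `B ⊆ locAt O₁ B`.

Proof.
* `isLocalization_locAt` — `locAt O₁ B` is a localisation of `B` (along the inclusion, at the
  elements of `B` that become units, i.e. the `O₁`-units): every element is `a * s⁻¹` with
  `a, s ∈ B`, `O₁.valuation s = 1` (`mem_locAt_iff`), and the inclusion is injective.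
* `isOpen_regularLocus_of_essFiniteType` — the regular locus of an algebra essentially of finite
  type over a field is open: it is a localisation of a finite type algebra `B₀`, `Reg(B₀)` is open
  (Matsumura, Cor. to Thm. 30.5, tree `Matsumura1987_30_5_cor_holds`), and the regular locus of a
  localisation is the preimage of the regular locus (tree
  `isOpen_regularLocus_of_isLocalization`, `QuasiExcellentLocalization.lean`).
* `vanishingIdeal_compl_regularLocus_of_isLocalization` — for any localisation `R → T` with
  `Sing(R) = Reg(R)ᶜ` closed: `Sing(R) = V(I)` for `I` its (radical) vanishing ideal, `Sing(T)` is
  the preimage `V(I T)`, so its vanishing ideal is `√(I T) = (√I) T = I T`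
  (`IsLocalization.map_radical`).
* `singIdeal_eq_vanishingIdeal` — `singIdeal B` is the vanishing ideal of `Reg(B)ᶜ` (unfolding).
-/

noncomputable section

-- single-problem summit: the doubled namespace component `ResolutionOfSingularities` is forced
set_option linter.dupNamespace false

namespace Summit.ResolutionOfSingularities.ResolutionOfSingularities.Theorems.SyzygyFlattening

open IsLocalRing Literature.AlgebraicGeometry.Resolution

universe u

/-! ## The non-regular locus of a localisation (abstract rings) -/

/-- For a localisation `T = N⁻¹R` whose base has closed non-regular locus `Reg(R)ᶜ`, the
vanishing ideal of the non-regular locus of `T` is the extension of that of `R`: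
`Reg(R)ᶜ = V(I)` with `I` radical, `Reg(T)ᶜ = V(I T)` (the local rings of `T` are local rings of
`R`), and `√(I T) = (√I) T = I T` for a localisation. [folklore] -/
theorem vanishingIdeal_compl_regularLocus_of_isLocalization {R T : Type u} [CommRing R]
    [CommRing T] [Algebra R T] (N : Submonoid R) [IsLocalization N T]
    (h : IsClosed (regularLocus R)ᶜ) :
    PrimeSpectrum.vanishingIdeal (regularLocus T)ᶜ =
      (PrimeSpectrum.vanishingIdeal (regularLocus R)ᶜ).map (algebraMap R T) := by
  set I : Ideal R := PrimeSpectrum.vanishingIdeal (regularLocus R)ᶜ with hI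
  have h1 : (regularLocus R)ᶜ = PrimeSpectrum.zeroLocus (I : Set R) := by
    rw [hI, PrimeSpectrum.zeroLocus_vanishingIdeal_eq_closure, h.closure_eq]
  have h2 : (regularLocus T)ᶜ = PrimeSpectrum.zeroLocus ((I.map (algebraMap R T) : Ideal T) : Set T) := by
    rw [regularLocus_eq_preimage_comap_of_isLocalization N, ← Set.preimage_compl, h1,
      PrimeSpectrum.preimage_comap_zeroLocus, ← PrimeSpectrum.zeroLocus_span]
    rfl
  rw [h2, PrimeSpectrum.vanishingIdeal_zeroLocus_eq_radical, ← IsLocalization.map_radical N T,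
    (PrimeSpectrum.isRadical_vanishingIdeal _).radical]

/-- **The regular locus of an algebra essentially of finite type over a field is open**: such an
algebra is a localisation of a finitely generated subalgebra `B₀`, `Reg(B₀)` is open (Matsumura,
Cor. to Thm. 30.5), and the regular locus of a localisation is the preimage of the regular locus
of the base under the (continuous) map of spectra. [cite: Matsumura1987, §30 Cor. to Thm. 30.5] -/
theorem isOpen_regularLocus_of_essFiniteType (k R : Type u) [Field k] [CommRing R] [Algebra k R]
    [Algebra.EssFiniteType k R] : IsOpen (regularLocus R) :=
  isOpen_regularLocus_of_isLocalization (Algebra.EssFiniteType.submonoid k R)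
    (Matsumura1987_30_5_cor_holds k ↥(Algebra.EssFiniteType.subalgebra k R) inferInstance)

/-! ## `locAt O B` is a localisation of `B`, and `singIdeal` is a vanishing ideal -/

variable {k K : Type} [Field k] [Field K] [Algebra k K]

/-- `singIdeal B` is the vanishing ideal of the non-regular locus `Reg(B)ᶜ ⊆ Spec B`. [folklore] -/
theorem singIdeal_eq_vanishingIdeal (B : Subalgebra k K) :
    singIdeal B = PrimeSpectrum.vanishingIdeal (regularLocus ↥B)ᶜ := by
  rw [singIdeal, sInf_image, PrimeSpectrum.vanishingIdeal]
  rfl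

/-- **`locAt O B` is a localisation of `B`** (`B ⊆ O`): along the inclusion
`B ≤ locAt O B` (as the `B`-algebra structure), `locAt O B` is the localisation of `B` at the
submonoid of elements that become units in `locAt O B` — every element is `a * s⁻¹` with
`a, s ∈ B` and `s` an `O`-unit (`mem_locAt_iff`), `O`-units of `B` are inverted in `locAt O B`
(`inv_mem_locAt`), and the inclusion is injective. [cite: NovacoskiSpivakovsky2014, Def. 2.8] -/
theorem isLocalization_locAt (O : ValuationSubring K) (B : Subalgebra k K)
    (h : B.toSubring ≤ O.toSubring) :
    @IsLocalization ↥B _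
      ((IsUnit.submonoid ↥(locAt O B)).comap (Subalgebra.inclusion (self_le_locAt O B)))
      ↥(locAt O B) _ (Subalgebra.inclusion (self_le_locAt O B)).toRingHom.toAlgebra := by
  letI : Algebra ↥B ↥(locAt O B) := (Subalgebra.inclusion (self_le_locAt O B)).toRingHom.toAlgebra
  exact
    { map_units := fun s => s.2
      surj := fun y => by
        obtain ⟨a, ha, s, hs, hv, hy⟩ := (mem_locAt_iff O B h).mp y.2
        have hs0 : s ≠ 0 := ne_zero_of_valuation_eq_one hv
        have hsi : s⁻¹ ∈ locAt O B := inv_mem_locAt O B h (self_le_locAt O B hs) hv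
        have hunit : IsUnit (Subalgebra.inclusion (self_le_locAt O B) ⟨s, hs⟩) :=
          IsUnit.of_mul_eq_one (⟨s⁻¹, hsi⟩ : ↥(locAt O B)) (Subtype.ext (mul_inv_cancel₀ hs0))
        refine ⟨(⟨a, ha⟩, ⟨⟨s, hs⟩, hunit⟩), Subtype.ext ?_⟩
        change (y : K) * s = a
        rw [hy, inv_mul_cancel_right₀ hs0]
      exists_of_eq := fun {a b} hab =>
        ⟨1, by rw [Subalgebra.inclusion_injective (self_le_locAt O B) hab]⟩ }

/-! ## The registered stub -/

/-- **STUB `stub_singIdeal_locAt` (the non-regular locus localises).** For `B ⊆ O₁` essentially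
of finite type over `k` with `Frac B = K`, the ideal of the non-regular locus of the localisation
`locAt O₁ B` is the extension of that of `B`: the regular locus of `B` is open (Matsumura,
Cor. to Thm. 30.5, tree `Matsumura1987_30_5_cor_holds`, transported to localisations), so the
non-regular locus is `V(I)` and both sides are `√I` extended. (`Frac B = K` is not used.)
[cite: Matsumura1987, §30 Cor. to Thm. 30.5] -/
theorem stub_singIdeal_locAt : ∀ (k K : Type) [Field k] [Field K] [Algebra k K]
    (O₁ : ValuationSubring K) (B : Subalgebra k K), B.toSubring ≤ O₁.toSubring →
      Algebra.EssFiniteType k ↥B → IsFractionRing ↥B K →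
      singIdeal (locAt O₁ B) = (singIdeal B).map (Subalgebra.inclusion (self_le_locAt O₁ B)) := by
  intro k K _ _ _ O₁ B hB hess _hfrac
  letI : Algebra ↥B ↥(locAt O₁ B) :=
    (Subalgebra.inclusion (self_le_locAt O₁ B)).toRingHom.toAlgebra
  haveI := isLocalization_locAt O₁ B hB
  haveI := hess
  have hopen : IsOpen (regularLocus ↥B) := isOpen_regularLocus_of_essFiniteType k ↥B
  rw [singIdeal_eq_vanishingIdeal, singIdeal_eq_vanishingIdeal,
    vanishingIdeal_compl_regularLocus_of_isLocalization
      ((IsUnit.submonoid ↥(locAt O₁ B)).comap (Subalgebra.inclusion (self_le_locAt O₁ B)))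
      (isClosed_compl_iff.mpr hopen)]
  rfl

end Summit.ResolutionOfSingularities.ResolutionOfSingularities.Theorems.SyzygyFlattening

end
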